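import Summits.BirchSwinnertonDyer.BirchSwinnertonDyer.Theorems.GenusKolyvaginAtTwoPowDvdShaCardAtTwoRTGrossLevelAtTwo
import Literature.NumberTheory.GaloisRepresentations.LocalGlobalCohomology
import HarnessLib

/-!
# Route `GenusKolyvaginAtTwo`, LINE 18 (L_T `PowDvdShaCardAtTwoRT`, stmt-BirchSwinnertonDyer-23242): the bottom-rung engine's
# hypothesis `ht4` (level-4 Gross at the witness primes) FOLLOWS from its frame `hTK` on the habitat

Seat `bsd-line-gk2-p5` g22 (cell `bsd-f1-sign2`, SUPPLY lineage), `--supports stmt-BirchSwinnertonDyer-23242` (helper; it closes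
nothing and BSD is not proved by it).

The one-step engines `RelaxedCount.false_of_bottomRung_engine{,_cheb,_deep}` (LEAD gk2-p1 g16/g17, p708250/p710582) display, next to
the frame `hTK` of the own primes `u ∈ s ∪ t` (`FrobEqFrobInfty W K 2 ℓ ∧ 2 ≤ Zhang2014.kolyvaginIndex W 2 ℓ ∧
Zhang2014.IsKolyvaginPrime …`), the separate hypothesis `ht4 : ∀ v ℓ, ℓ.Prime → Sum.inr v ∈ t → ℓ ∈ v → FrobEqFrobInfty W K (2^2) ℓ`
(LEAD memo g17 §6 «(β″)-precise»: at `p = 2` Zhang's index `≥ 2` alone does not give Gross's condition modulo `4`).  By the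
level-lifting theorem `GrossLevelAtTwo.frobEqFrobInfty_two_pow_of_frobEqFrobInfty_two` (this seat, `…RTGrossLevelAtTwo`), on the
habitat (`Δ < 0`, the `2`-adic tower onto, `K` imaginary quadratic) `ht4` is a CONSEQUENCE of `hTK` — at the primes of `t` and of
`s` alike:

* `frobEqFrobInfty_four_of_hTK` — `hTK` ⟹ `∀ v ℓ, ℓ.Prime → Sum.inr v ∈ s ∪ t → ℓ ∈ v → FrobEqFrobInfty W K (2^2) ℓ`;
* `ht4_of_hTK` — the engine's `ht4` VERBATIM (primes of `t`).

Use (LEAD / KS assembler): `… (ht4 := GrossLevelAtTwo.ht4_of_hTK W K hK hΔ hρ s t hTK) …`.  BSD is not proved by any of this.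

References: [GrossLMS1991] §3 (3.1)–(3.3); [McCallumLMS1991] §4 (p. 299); [WZhang2014] Notations (xii).
-/

set_option linter.dupNamespace false
set_option autoImplicit false

noncomputable section

open scoped Classical

namespace Summit.BirchSwinnertonDyer.BirchSwinnertonDyer.Theorems.GenusExact.GrossLevelAtTwo

open Field NumberField IsDedekindDomain WeierstrassCurve Rat.HeightOneSpectrum
open Literature.NumberTheory.EllipticCurves Literature.NumberTheory.GaloisRepresentations

variable (W : WeierstrassCurve ℚ) [W.IsElliptic] [W.IsGloballyMinimal] (K : Type) [Field K] [NumberField K]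

/-- **Level-4 Gross at every own prime of the engine's frame.** On the habitat (`Δ < 0`, `∀ n, ρ_{E,2^n}` onto, `K` imaginary
quadratic), the frame `hTK` of `false_of_bottomRung_engine{,_cheb,_deep}` gives `FrobEqFrobInfty W K (2^2) ℓ` at the prime `ℓ` of
every `u = Sum.inr v ∈ s ∪ t` (the prime in `v` is unique). [cite: GrossLMS1991, §3 (3.1)–(3.3)] [cite: McCallumLMS1991, §4 (p. 299)] -/
theorem frobEqFrobInfty_four_of_hTK (hK : IsImaginaryQuadratic K) (hΔ : W.Δ < 0)
    (hρ : ∀ n : ℕ, W.HasSurjectiveModNGaloisRep (2 ^ n : ℕ)) (s t : Finset (Place ℚ))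
    (hTK : ∀ u ∈ s ∪ t, ∃ (v : HeightOneSpectrum (𝓞 ℚ)) (ℓ : ℕ) (_ : Fact ℓ.Prime), u = Sum.inr v ∧ ℓ ≠ 2 ∧
      (ℓ : 𝓞 ℚ) ∈ v.asIdeal ∧ W.HasGoodReductionAtPrime ℓ ∧ FrobEqFrobInfty W K 2 ℓ ∧ 2 ≤ Zhang2014.kolyvaginIndex W 2 ℓ ∧
      Zhang2014.IsKolyvaginPrime (W.conductorNorm ℤ) W K 2 ℓ) :
    ∀ (v : HeightOneSpectrum (𝓞 ℚ)) (ℓ : ℕ), ℓ.Prime → Sum.inr v ∈ s ∪ t → (ℓ : 𝓞 ℚ) ∈ v.asIdeal →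
      FrobEqFrobInfty W K (2 ^ 2) ℓ := by
  intro v ℓ hℓ hv hℓv
  obtain ⟨v', ℓ', _, huv, -, hℓ'v, -, hG, hidx, hZ⟩ := hTK (Sum.inr v) hv
  have hvv : v' = v := (Sum.inr_injective huv).symm
  subst hvv
  -- the prime in `v` is unique
  have hℓℓ : ℓ = ℓ' :=
    (primesEquiv_eq_of_natCast_mem hℓ hℓv).symm.trans (primesEquiv_eq_of_natCast_mem hZ.1 hℓ'v)
  subst hℓℓ
  exact frobEqFrobInfty_two_pow_of_frobEqFrobInfty_two W K hK hΔ (by norm_num) (hρ 2) hZ hidx hG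

/-- **The engine's `ht4` from its `hTK`**, verbatim the hypothesis `ht4` of `RelaxedCount.false_of_bottomRung_engine_deep` (primes of
`t`). [cite: GrossLMS1991, §3 (3.1)–(3.3)] [cite: McCallumLMS1991, §4 (p. 299)] -/
theorem ht4_of_hTK (hK : IsImaginaryQuadratic K) (hΔ : W.Δ < 0)
    (hρ : ∀ n : ℕ, W.HasSurjectiveModNGaloisRep (2 ^ n : ℕ)) (s t : Finset (Place ℚ))
    (hTK : ∀ u ∈ s ∪ t, ∃ (v : HeightOneSpectrum (𝓞 ℚ)) (ℓ : ℕ) (_ : Fact ℓ.Prime), u = Sum.inr v ∧ ℓ ≠ 2 ∧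
      (ℓ : 𝓞 ℚ) ∈ v.asIdeal ∧ W.HasGoodReductionAtPrime ℓ ∧ FrobEqFrobInfty W K 2 ℓ ∧ 2 ≤ Zhang2014.kolyvaginIndex W 2 ℓ ∧
      Zhang2014.IsKolyvaginPrime (W.conductorNorm ℤ) W K 2 ℓ) :
    ∀ (v : HeightOneSpectrum (𝓞 ℚ)) (ℓ : ℕ), ℓ.Prime → Sum.inr v ∈ t → (ℓ : 𝓞 ℚ) ∈ v.asIdeal →
      FrobEqFrobInfty W K (2 ^ 2) ℓ :=
  fun v ℓ hℓ hv hℓv ↦ frobEqFrobInfty_four_of_hTK W K hK hΔ hρ s t hTK v ℓ hℓ (Finset.mem_union_right s hv) hℓv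

end Summit.BirchSwinnertonDyer.BirchSwinnertonDyer.Theorems.GenusExact.GrossLevelAtTwo

end
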